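import Mathlib.Analysis.SpecialFunctions.Complex.Circle
import Mathlib.RingTheory.RootsOfUnity.Complex
import Mathlib.Topology.Instances.ZMod
import Literature.IUT.HodgeArakelov.LabelClassesOfCusps
import HarnessLib

/-!
# [IUTchII] Def 2.3 (i): the `±`-tower interface `PlusMinusTower` is inhabited (NV-L6 wave, DEGENERATE witness)

Mochizuki, *Inter-universal Teichmüller Theory II*, kurims manuscript (Dec. 2020), §2, Def 2.3 (i) p.67
("`Δ_v ⊆ Δ^±_v ⊆ Δ^cor_v`, `Π_v ⊆ Π^±_v ⊆ Π^cor_v` and their profinite completions … `Δ̂_v` a normal open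
subgroup of `Δ̂^±_v` of index `l`, `Δ̂^±_v` a normal open subgroup of `Δ̂^cor_v` of index `2l`"), typed by
abc-iut-L6-t1 as the structure `PlusMinusTower T` over the Prop 2.1 data `T : TemperedCoverings S P` of a
`S : BadPlaceSetting` (`LabelClassesOfCusps.lean`, `ThetaEvaluationSetting.lean`).  [claim: Mochizuki2012,
status: disputed] — this file asserts NOTHING of the series.

NV-L6 WAVE (abc-iut-L6-lead §F v1.18p, 2026-08-26T02:59:23Z; w5-d114 INHABITATION-CENSUS-L6 v3 §A: ZERO
producers for `PlusMinusTower`, and no closed `Nonempty` row for `HodgeArakelov.ThetaSetting`,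
`BadPlaceSetting`, `TemperedCoverings` either).  This PROOF-ONLY file (no `def`, no `instance`, no
`structure`; every witness is built INSIDE a theorem term) kernel-checks that the axiom sets of the four
interfaces are JOINTLY SATISFIABLE, by a **DEGENERATE** witness:

* `l := 3`, `p := 5`, `N := 1`, `k := ℂ` (a primitive `12`-th root of unity exists); ALL tempered /
  Galois groups of the setting TRIVIAL (`Π_v = Π^tp_{X_v} = G_v = 1`, model mono-theta group `1`), all
  reference subgroups `⊤`;
* the `±`-tower: the ambient "`Π̂^cor_v`" is the ARTIFICIAL finite abelian group
  `C₃ × C₆ = Multiplicative (ZMod 3) × Multiplicative (ZMod 6)` (discrete), `Π̂_v := 1`,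
  `Π̂^±_v := C₃ × 1` (the kernel of the second projection), `Π^cor_v := ⊤`, `Π^±_v ↪` trivially,
  `G_v = 1`; so `Δ̂_v ⊲ Δ̂^±_v` has index `3 = l` and `Δ̂^±_v ⊲ Δ̂^cor_v` has index `6 = 2l` — the printed
  index pattern is supplied by a cyclic factor, NOT by the geometry of `X̲̲_v → X_v → C_v`.

* over the same degenerate setting: the Prop 1.4 output `EtaleThetaData` with TRIVIAL cohomology
  (`H¹ = lim = 0`, orbit `= θ(Π_v) = {0}`), the Prop 2.2 (i) data `SubgraphDecomposition` (`Π_{v•} = Π_{v▶} = 1`,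
  `ι = id`), and — second NV-L6 name of this seat — the FROZEN v1 structure `IotaInvariantTheta`
  (Prop 2.2 (ii), LITERAL `ι`-fixed points) with `ι := id`: on `θ(Π_v) = {0}` the literal fixed-point and
  `μ_{2l}`-orbit clauses hold.  This is the ONLY kind of inhabitant v1 admits: at a genuine
  `EtaleThetaData` (`θ(Π_v)` an `(l·ℤ × μ_{2l})`-torsor) the geometric `ι` has no literal fixed point
  (abc-iut-L6-t19, `IotaInvariantTheta.false_of_fixedPointFree`, `IotaInvariantThetaNegative.lean`) and
  `ι = id` violates the orbit clause; the series' content is carried by the repair `IotaInvariantTheta'`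
  (8 producers).  So: v1 is CONSISTENT as typed (this file) and superseded in substance (L6-t19).

HONEST LABEL (protocol (4)): `nonempty_degenerate` — trivial carriers and an artificial completion; it says
that the TYPED axioms of Def 2.3 (i), Prop 1.4, Prop 2.2 (i)/(ii)-v1 (with those of Prop 2.1 and of the
bad-place setting) are consistent, nothing about the tempered fundamental groups of a curve.  A GENUINE `Π̂^cor_v` needs the profinite
completions of [IUTchI] §2 / [EtTh] §2 at the model (L5 `StableCurveTemperedData`, bridge
`PlusMinusTowerStableCurveBridge`), whose own inhabitation is upstream.  No named fact, no `sorry`.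
Nothing here bears on, or takes a side on, [IUTchIII] Cor. 3.12.
-/

noncomputable section

namespace Literature.IUT.HodgeArakelov

open Topology

/-- **[IUTchII] Def 2.3 (i) — the interface stack `BadPlaceSetting → TemperedCoverings → PlusMinusTower`
is inhabited (DEGENERATE witness)**: trivial tempered/Galois groups, `l = 3`, `p = 5`, `k = ℂ`, and the
artificial ambient group `C₃ × C₆` carrying `Π̂_v = 1 ⊲ Π̂^±_v = C₃ × 1 ⊲ Π̂^cor_v` with the printed indices
`l`, `2l`.  [claim: Mochizuki2012, status: disputed] (IUTchII §2 Def 2.3 (i), kurims p.67)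
[cite: Mochizuki2012, II Def 2.3 (i) p.67] -/
theorem nonempty_degenerate_stack :
    ∃ (S : BadPlaceSetting.{0}) (P : TopGroup.{0}) (T : TemperedCoverings S P),
      Nonempty (PlusMinusTower T) ∧
        ∃ (D : EtaleThetaData S.toThetaSetting P) (Dec : SubgraphDecomposition S T D),
          Nonempty (IotaInvariantTheta Dec) := by
  classical
  -- the degenerate bad-place setting: every group trivial
  let S : BadPlaceSetting.{0} :=
    { N := 1
      l := 3
      l_prime := Nat.prime_three
      l_odd := by norm_num
      p := 5
      p_prime := Nat.prime_five
      p_odd := by norm_num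
      p_ne_l := by norm_num
      k := ℂ
      hasPrimitiveRoot := ⟨_, Complex.isPrimitiveRoot_exp 12 (by norm_num)⟩
      PiX := TopGroup.of PUnit.{1}
      Gk := TopGroup.of PUnit.{1}
      aug := MonoidHom.id _
      aug_continuous := continuous_id
      aug_surjective := fun x => ⟨x, rfl⟩
      modelPi := TopGroup.of PUnit.{1}
      modelD := ⊤
      modelD_inn := le_top
      modelD_continuous := fun φ _ =>
        ⟨continuous_of_discreteTopology, continuous_of_discreteTopology⟩
      modelTheta := ∅
      PiXplain := TopGroup.of PUnit.{1}
      inclPlain := MonoidHom.id _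
      inclPlain_isOpenEmbedding := Topology.IsOpenEmbedding.id
      refY := ⊤
      refYdd := ⊤
      refYdd_le := le_rfl
      isOpen_refY := isOpen_discrete _
      isOpen_refYdd := isOpen_discrete _ }
  -- the degenerate Prop 2.1 diagram over `P := Π_v = 1`
  let T : TemperedCoverings S (TopGroup.of PUnit.{1}) :=
    { isoRef := ⟨ContinuousMulEquiv.refl _⟩
      Xplain := TopGroup.of PUnit.{1}
      incl := MonoidHom.id _
      incl_isOpenEmbedding := Topology.IsOpenEmbedding.id
      Y := ⊤
      Ydd := ⊤
      Ydd_le := le_rfl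
      isOpen_Y := isOpen_discrete _
      isOpen_Ydd := isOpen_discrete _
      corresponds := ⟨ContinuousMulEquiv.refl _, ContinuousMulEquiv.refl _, fun _ => rfl,
        Subgroup.ext fun x => ⟨fun _ => trivial, fun _ => ⟨x, trivial, rfl⟩⟩,
        Subgroup.ext fun x => ⟨fun _ => trivial, fun _ => ⟨x, trivial, rfl⟩⟩⟩ }
  -- the degenerate Prop 1.4 output: trivial cohomology, orbit `= θ = {0}`
  let D : EtaleThetaData S.toThetaSetting (TopGroup.of PUnit.{1}) :=
    { isoRef := ⟨ContinuousMulEquiv.refl _⟩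
      PiYddRef := ⊤
      PiYdd := ⊤
      isOpen_PiYdd := isOpen_discrete _
      PiYdd_corresponds := fun _ => Subgroup.ext fun x => ⟨fun _ => trivial, fun _ => ⟨1, trivial, Subsingleton.elim _ _⟩⟩
      lDeltaTheta := { top := ⊥, bot := ⊥, le := le_rfl, normal := inferInstance }
      coh :=
        { H1 := fun _ => PUnit.{1}
          res := fun _ => 0
          lim := PUnit.{1}
          toLim := fun _ => 0
          toLim_res := fun _ _ => rfl }
      orbit := Set.univ
      orbit_nonempty := ⟨0, trivial⟩
      theta := Set.univ
      theta_eq := Set.ext fun _ => ⟨fun _ => ⟨0, trivial, Subsingleton.elim _ _⟩, fun _ => trivial⟩ }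
  -- the degenerate Prop 2.2 (i) data: `Π_{v•} = Π_{v▶} = 1`, `ι = id`
  let Dec : SubgraphDecomposition S T D :=
    { Pbullet := ⊥
      Ptri := ⊥
      bullet_le_tri := le_rfl
      tri_le_YL := bot_le
      iota := ContinuousMulEquiv.refl _
      iota_bullet := Subgroup.map_bot _
      iota_tri := Subgroup.map_bot _
      iota_Ydd := Subgroup.ext fun x => ⟨fun _ => trivial, fun _ => ⟨x, trivial, rfl⟩⟩
      refTri := ⊥
      refBullet := ⊥
      corresponds := ⟨ContinuousMulEquiv.refl _, 1, by rw [Subgroup.map_bot, Subgroup.map_bot],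
        by rw [Subgroup.map_bot, Subgroup.map_bot]⟩ }
  -- the artificial ambient group `C₃ × C₆`
  let F : Type := Multiplicative (ZMod 3) × Multiplicative (ZMod 6)
  have hF : Nat.card F = 18 := by
    simp only [F, Nat.card_eq_fintype_card, Fintype.card_prod, Fintype.card_multiplicative, ZMod.card]
  -- `Π̂^±_v := C₃ × 1`, the kernel of the second projection; its index is `|C₆| = 6`
  have hidx : (MonoidHom.snd (Multiplicative (ZMod 3)) (Multiplicative (ZMod 6))).ker.index = 6 := by
    rw [Subgroup.index_ker, MonoidHom.range_eq_top.2 Prod.snd_surjective, Subgroup.card_top,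
      Nat.card_eq_fintype_card, Fintype.card_multiplicative, ZMod.card]
  -- hence its order is `3`
  have hcard : Nat.card (MonoidHom.snd (Multiplicative (ZMod 3)) (Multiplicative (ZMod 6))).ker = 3 := by
    have h := (MonoidHom.snd (Multiplicative (ZMod 3)) (Multiplicative (ZMod 6))).ker.card_mul_index
    rw [hidx] at h
    have h18 : Nat.card (Multiplicative (ZMod 3) × Multiplicative (ZMod 6)) = 18 := hF
    omega
  refine ⟨S, TopGroup.of PUnit.{1}, T, ⟨?_⟩, D, Dec, ⟨?_⟩⟩
  · exact
    { Corhat := TopGroup.of F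
      cor := ⊤
      pmHat := (MonoidHom.snd (Multiplicative (ZMod 3)) (Multiplicative (ZMod 6))).ker
      hat := ⊥
      emb := 1
      emb_injective := Function.injective_of_subsingleton _
      aug := 1
      aug_surjective := fun x => ⟨1, Subsingleton.elim _ _⟩
      hat_le_pmHat := bot_le
      emb_le_pmHat := by rw [MonoidHom.range_one]; exact bot_le
      embP_le_hat := by rw [MonoidHom.one_comp, MonoidHom.range_one]
      embP_le_cor := le_top
      pmHat_normal := inferInstance
      deltaHat_normal := inferInstance
      deltaHat_index := by
        show ((⊥ ⊓ (1 : F →* PUnit.{1}).ker).subgroupOf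
          ((MonoidHom.snd (Multiplicative (ZMod 3)) (Multiplicative (ZMod 6))).ker ⊓
            (1 : F →* PUnit.{1}).ker)).index = 3
        rw [MonoidHom.ker_one, inf_top_eq, bot_inf_eq, Subgroup.bot_subgroupOf, Subgroup.index_bot, hcard]
      deltaPmHat_normal := inferInstance
      deltaPmHat_index := by
        show (((MonoidHom.snd (Multiplicative (ZMod 3)) (Multiplicative (ZMod 6))).ker ⊓
          (1 : F →* PUnit.{1}).ker).subgroupOf (1 : F →* PUnit.{1}).ker).index = 2 * 3
        rw [MonoidHom.ker_one, inf_top_eq]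
        exact (Subgroup.relIndex_top_right _).trans hidx
      aug_compat := ⟨ContinuousMulEquiv.refl _, fun _ => Subsingleton.elim _ _⟩ }
  · -- the v1 `IotaInvariantTheta` with `ι := id` on `θ(Π_v) = {0}`
    exact
    { iotaH1 := AddEquiv.refl _
      iotaLim := AddEquiv.refl _
      iota_compat := fun _ => rfl
      iota_theta := Set.image_id _
      thetaIota_nonempty := ⟨0, trivial, rfl⟩
      thetaIota_orbit := fun _ _ _ _ _ _ => Subsingleton.elim _ _ }

/-- **[IUTchII] Def 2.3 (i) — `PlusMinusTower` inhabited (DEGENERATE witness)**: see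
`nonempty_degenerate_stack`. [claim: Mochizuki2012, status: disputed] (IUTchII §2 Def 2.3 (i), kurims p.67)
[cite: Mochizuki2012, II Def 2.3 (i) p.67] -/
theorem PlusMinusTower.nonempty_degenerate :
    ∃ (S : BadPlaceSetting.{0}) (P : TopGroup.{0}) (T : TemperedCoverings S P),
      Nonempty (PlusMinusTower T) := by
  obtain ⟨S, P, T, hW, -⟩ := nonempty_degenerate_stack
  exact ⟨S, P, T, hW⟩

/-- **[IUTchII] Prop 2.2 (ii), v1 (literal `ι`-fixed points) — `IotaInvariantTheta` inhabited (DEGENERATE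
witness, `ι = id`, `θ(Π_v) = {0}`)**: the frozen v1 structure is CONSISTENT as typed; at genuine data it is
superseded by `IotaInvariantTheta'` (abc-iut-L6-t19). [claim: Mochizuki2012, status: disputed]
(IUTchII §2 Prop 2.2 (ii), kurims p.66) [cite: Mochizuki2012, II Prop 2.2 (ii) p.66] -/
theorem IotaInvariantTheta.nonempty_degenerate :
    ∃ (S : BadPlaceSetting.{0}) (P : TopGroup.{0}) (T : TemperedCoverings S P)
      (D : EtaleThetaData S.toThetaSetting P) (Dec : SubgraphDecomposition S T D),
      Nonempty (IotaInvariantTheta Dec) := by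
  obtain ⟨S, P, T, -, D, Dec, h⟩ := nonempty_degenerate_stack
  exact ⟨S, P, T, D, Dec, h⟩

/-- **[IUTchII] Prop 1.4 output interface — `EtaleThetaData` has a CLOSED inhabitant (DEGENERATE: trivial
cohomology).** [claim: Mochizuki2012, status: disputed] (IUTchII §1 Prop 1.4, kurims p.27)
[cite: Mochizuki2012, II Prop 1.4 p.27] -/
theorem EtaleThetaData.nonempty_degenerate :
    ∃ (S : BadPlaceSetting.{0}) (P : TopGroup.{0}), Nonempty (EtaleThetaData S.toThetaSetting P) := by
  obtain ⟨S, P, -, -, D, -, -⟩ := nonempty_degenerate_stack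
  exact ⟨S, P, ⟨D⟩⟩

/-- **[IUTchII] Prop 2.2 (i) output interface — `SubgraphDecomposition` has a CLOSED inhabitant (DEGENERATE).**
[claim: Mochizuki2012, status: disputed] (IUTchII §2 Prop 2.2 (i), kurims p.66) [cite: Mochizuki2012, II Prop 2.2 (i) p.66] -/
theorem SubgraphDecomposition.nonempty_degenerate :
    ∃ (S : BadPlaceSetting.{0}) (P : TopGroup.{0}) (T : TemperedCoverings S P)
      (D : EtaleThetaData S.toThetaSetting P), Nonempty (SubgraphDecomposition S T D) := by
  obtain ⟨S, P, T, -, D, Dec, -⟩ := nonempty_degenerate_stack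
  exact ⟨S, P, T, D, ⟨Dec⟩⟩

/-- **[IUTchII] §1/§2 setting interfaces inhabited (DEGENERATE)**: `BadPlaceSetting` (hence L6-t1's
`HodgeArakelov.ThetaSetting`) has a closed inhabitant — all groups trivial, `l = 3`, `p = 5`, `k = ℂ`.
[claim: Mochizuki2012, status: disputed] (IUTchII §2 Prop 2.1, kurims p.64) [cite: Mochizuki2012, II Prop 2.1 p.64] -/
theorem BadPlaceSetting.nonempty_degenerate : Nonempty BadPlaceSetting.{0} := by
  obtain ⟨S, -, -, -⟩ := PlusMinusTower.nonempty_degenerate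
  exact ⟨S⟩

/-- **[IUTchII] §1 setting interface inhabited (DEGENERATE)**: L6-t1's `HodgeArakelov.ThetaSetting` has a
closed inhabitant (the one underlying `BadPlaceSetting.nonempty_degenerate`).
[claim: Mochizuki2012, status: disputed] (IUTchII §1, kurims p.20) [cite: Mochizuki2012, II §1 p.20] -/
theorem ThetaSetting.nonempty_degenerate : Nonempty ThetaSetting.{0} := by
  obtain ⟨S⟩ := BadPlaceSetting.nonempty_degenerate
  exact ⟨S.toThetaSetting⟩

/-- **[IUTchII] Prop 2.1 interface inhabited (DEGENERATE)**: some `TemperedCoverings S P` is inhabited by a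
closed witness (trivial groups; the top row of the diagram is then also trivial).
[claim: Mochizuki2012, status: disputed] (IUTchII §2 Prop 2.1, kurims pp.64–65) [cite: Mochizuki2012, II Prop 2.1 p.64] -/
theorem TemperedCoverings.nonempty_degenerate :
    ∃ (S : BadPlaceSetting.{0}) (P : TopGroup.{0}), Nonempty (TemperedCoverings S P) := by
  obtain ⟨S, P, T, -⟩ := PlusMinusTower.nonempty_degenerate
  exact ⟨S, P, ⟨T⟩⟩

end Literature.IUT.HodgeArakelov

end
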